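import Mathlib
import Summits.CriticalPhenomena.PercolationContinuityZ3.Theorems.PercNearOneGluingNoHeavyLowerTailHexMSMatchHybrid

/-!
# The hybrid certificate with free pairs paid by free cross differences ('hybrid-X') (hp-7 gen 80)

Support file for crux `stmt-CriticalPhenomena-4575` (route `PercNearOneGluingNoHeavy`), hull-port seat `prim-hp-7` (generation 80);
`--supports stmt-CriticalPhenomena-4575 --as helper`.  No `sorry`.  Memo: `run/shared/lean/prim/prim-hp-7/FROM-prim-hp-7-g80-TWO-DIRECTIONS.md` §6.

`Hybrid.two_mul_card_le_card_clU_scTerms_of_saturated` ranks the dead transversal `P ∪ co Q` and needs every cross meet `p ∩ q` to be a term,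
i.e. every cross pair blocked.  Here the unblocked ('free') pairs are allowed: their meets form an exceptional family `B` that is paid for by a
family `A` of extra reserved small terms which are never forward differences of the hybrid rank — in practice the free admissible cross
differences themselves (`p \ q ⊄ q'`, pure, undesignated).  Numerically (memo §6) EVERY derived depth-one two-type configuration tested
(exhaustive `2^[6]`, `#F ≤ 7`; random and annealed `n ≤ 9`; the parallel family with freed pairs) is tight-or-free or hybrid-X.

* `Hybrid.two_mul_card_le_card_clU_scTerms_of_freePaid` — (Π2″) from the hybrid rank with reserved family `D ∪ A` and exceptional meets `B`,
  `#B ≤ #A`.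
-/

namespace Summit.CriticalPhenomena.PercolationContinuityZ3.Theorems

namespace Hybrid

open Finset GeneratedDonors
open scoped FinsetFamily

variable {α : Type*} [DecidableEq α] {U : Finset α}

/-- **(Π2″) from the hybrid certificate when the unblocked pairs are paid for** (hp-7 gen 80; 'HYBRID-X').  As
`two_mul_card_le_card_clU_scTerms_of_saturated`, but the cross pairs need not all be blocked: every cross meet `p ∩ q` is a term OR lies in
an exceptional family `B`, and `B` is outnumbered by a family `A` of additional reserved small terms — in practice the FREE admissible cross
differences (`p \ q ∉ W`, `p ∪ (U \ q) ∉ W`): not within-block differences (hence nonempty), never a cross meet (`a ⊄ q` resp. `a ⊄ p`), not designated.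
Then `2 (#P + #Q + #W) ≤ #clU U (scTerms P Q W)`.  (Rank `P ∪ co Q`, reserve `D ∪ A`; the forward meets outside the terms cost at most `#B ≤ #A`.)
Numerically (memo §6): 'tight-or-free OR hybrid-X' holds for every DERIVED configuration tested (n ≤ 9), hybrid-X alone for all parallel configurations
with freed pairs. -/
theorem two_mul_card_le_card_clU_scTerms_of_freePaid (P Q W A B : Finset (Finset α))
    (hU : ∀ a ∈ P ∪ Q, a ⊆ U)
    (hint : ∀ a ∈ P ∪ Q, ∀ b ∈ P ∪ Q, (a ∩ b).Nonempty) (hcov : ∀ a ∈ P ∪ Q, ∀ b ∈ P ∪ Q, a ∪ b ≠ U)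
    (hrep : W ⊆ scReps U P Q) (hWco : ∀ a ∈ W, ∀ b ∈ W, a ≠ U \ b)
    (hC2 : ∀ w ∈ W, w ∉ clU U ((P \\ P) ∪ (Q \\ Q)))
    (hX1W : ∀ w ∈ W, ∀ q ∈ Q, ¬ w ⊆ q) (hX2W : ∀ p ∈ P, ∀ w ∈ W, p ∪ w ≠ U)
    (hmeet : ∀ p ∈ P, ∀ q ∈ Q, p ∩ q ∈ scTerms P Q W ∨ p ∩ q ∈ B)
    (hAT : ∀ a ∈ A, a ∈ scTerms P Q W ∧ ∃ f ∈ P ∪ Q, a ⊆ f)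
    (hApure : ∀ a ∈ A, a ∉ (P \\ P) ∪ (Q \\ Q)) (hAmeet : ∀ a ∈ A, ∀ p ∈ P, ∀ q ∈ Q, a ≠ p ∩ q)
    (hAW : ∀ a ∈ A, a ∉ W ∧ U \ a ∉ W) (hBA : #B ≤ #A) :
    2 * (#P + #Q + #W) ≤ #(clU U (scTerms P Q W)) := by
  classical
  set F := P ∪ Q with hFdef
  have hPF : ∀ {a}, a ∈ P → a ∈ F := fun ha => mem_union_left _ ha
  have hQF : ∀ {a}, a ∈ Q → a ∈ F := fun ha => mem_union_right _ ha
  have hcc : ∀ {a : Finset α}, a ⊆ U → U \ (U \ a) = a := fun ha => Finset.sdiff_sdiff_eq_self ha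
  have hWU : ∀ w ∈ W, w ⊆ U := fun w hw => subset_of_mem_scReps hU (hrep hw)
  -- the designated sets
  set D₅ : Finset (Finset α) := (P \\ Q).filter fun d => d ∈ W with hD₅def
  set D₂ : Finset (Finset α) := (Q \\ P).filter fun d => U \ d ∈ W with hD₂def
  set D := D₅ ∪ D₂ with hDdef
  have hWD : #W ≤ #D := ExtReserved.card_le_card_designated P Q W hU hrep hWco
  -- degenerate blocks
  rcases P.eq_empty_or_nonempty with hP0 | ⟨p₀, hp₀⟩
  · -- no `P`: no representatives, `W = ∅`, and (Π2″) is Marica–Schönheim for `Q`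
    have hW0 : W = ∅ := by
      rw [eq_empty_iff_forall_notMem]; intro w hw
      have := hrep hw; rw [hP0] at this; unfold scReps at this; simp at this
    have hsub : clU U (Q \\ Q) ⊆ clU U (scTerms P Q W) := by
      intro t ht
      rcases mem_clU.mp ht with h | ⟨s, hs, rfl⟩
      · refine mem_clU.mpr (Or.inl ?_); unfold scTerms; simp only [mem_union]
        exact Or.inl (Or.inl (Or.inl (Or.inl (Or.inl (Or.inl (Or.inr h))))))
      · refine mem_clU.mpr (Or.inr ⟨s, ?_, rfl⟩); unfold scTerms; simp only [mem_union]
        exact Or.inl (Or.inl (Or.inl (Or.inl (Or.inl (Or.inl (Or.inr hs))))))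
    have h1 := card_le_card hsub
    rw [card_clU_diffs Q (fun a ha => hU a (hQF ha)) (fun a ha b hb => hcov a (hQF ha) b (hQF hb))] at h1
    have h2 := Q.card_le_card_diffs
    have hcP : #P = 0 := by rw [hP0]; rfl
    have hcW : #W = 0 := by rw [hW0]; rfl
    omega
  rcases Q.eq_empty_or_nonempty with hQ0 | ⟨q₀, hq₀⟩
  · have hW0 : W = ∅ := by
      rw [eq_empty_iff_forall_notMem]; intro w hw
      have := hrep hw; rw [hQ0] at this; unfold scReps at this; simp at this
    have hsub : clU U (P \\ P) ⊆ clU U (scTerms P Q W) := by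
      intro t ht
      rcases mem_clU.mp ht with h | ⟨s, hs, rfl⟩
      · refine mem_clU.mpr (Or.inl ?_); unfold scTerms; simp only [mem_union]
        exact Or.inl (Or.inl (Or.inl (Or.inl (Or.inl (Or.inl (Or.inl h))))))
      · refine mem_clU.mpr (Or.inr ⟨s, ?_, rfl⟩); unfold scTerms; simp only [mem_union]
        exact Or.inl (Or.inl (Or.inl (Or.inl (Or.inl (Or.inl (Or.inl hs))))))
    have h1 := card_le_card hsub
    rw [card_clU_diffs P (fun a ha => hU a (hPF ha)) (fun a ha b hb => hcov a (hPF ha) b (hPF hb))] at h1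
    have h2 := P.card_le_card_diffs
    have hcQ : #Q = 0 := by rw [hQ0]; rfl
    have hcW : #W = 0 := by rw [hW0]; rfl
    omega
  -- facts about designated sets
  have hDsmall : ∀ d ∈ D, d ∈ scTerms P Q W ∧ (∃ f ∈ F, d ⊆ f) ∧ d ∉ (P \\ P) ∪ (Q \\ Q) ∧
      ∀ p ∈ P, ∀ q ∈ Q, d ≠ p ∩ q := by
    intro d hd
    rcases mem_union.mp hd with hd | hd
    · obtain ⟨hdPQ, hdW⟩ := mem_filter.mp hd
      obtain ⟨p, hp, q, hq, rfl⟩ := mem_diffs.mp hdPQ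
      refine ⟨?_, ⟨p, hPF hp, sdiff_subset⟩, fun h => hC2 _ hdW (mem_clU.mpr (Or.inl h)), ?_⟩
      · unfold scTerms; simp only [mem_union]
        exact Or.inl (Or.inl (Or.inl (Or.inl (Or.inl (Or.inr (mem_diffs.mpr ⟨p, hp, q, hq, rfl⟩))))))
      · intro p' hp' q' hq' h
        exact hX1W _ hdW q' hq' (h ▸ inter_subset_right)
    · obtain ⟨hdQP, hdW⟩ := mem_filter.mp hd
      obtain ⟨q, hq, p, hp, rfl⟩ := mem_diffs.mp hdQP
      refine ⟨?_, ⟨q, hQF hq, sdiff_subset⟩, fun h => hC2 _ hdW (mem_clU.mpr (Or.inr ⟨_, h, rfl⟩)), ?_⟩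
      · unfold scTerms; simp only [mem_union]
        exact Or.inl (Or.inl (Or.inl (Or.inl (Or.inr (mem_diffs.mpr ⟨q, hq, p, hp, rfl⟩)))))
      · intro p' hp' q' hq' h
        apply hX2W p' hp' _ hdW
        apply Subset.antisymm (union_subset (hU p' (hPF hp')) sdiff_subset)
        intro i hi
        by_cases hip : i ∈ p'
        · exact mem_union_left _ hip
        · refine mem_union_right _ (mem_sdiff.mpr ⟨hi, fun h' => hip ?_⟩)
          rw [h] at h'; exact (mem_inter.mp h').1
  -- the hybrid family
  set cQ : Finset (Finset α) := Q.image fun q => U \ q with hcQ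
  have hcardcQ : #cQ = #Q := by
    refine card_image_of_injOn ?_
    intro q hq q' hq' h
    have h1 := congrArg (fun t => U \ t) h
    simp only [hcc (hU q (hQF (mem_coe.mp hq))), hcc (hU q' (hQF (mem_coe.mp hq')))] at h1
    exact h1
  have hdisj : Disjoint P cQ := by
    rw [Finset.disjoint_left]
    intro p hp hpc
    obtain ⟨q, hq, hqp⟩ := mem_image.mp hpc
    obtain ⟨i, hi⟩ := hint p (hPF hp) q (hQF hq)
    rw [← hqp, mem_inter, mem_sdiff] at hi
    exact hi.1.2 hi.2
  set H := P ∪ cQ with hH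
  have hcardH : #H = #P + #Q := by rw [card_union_of_disjoint hdisj, hcardcQ]
  -- the term set: small terms
  set Θ := D ∪ A with hΘdef
  have hΘcard : #Θ = #D + #A := by
    rw [hΘdef, card_union_of_disjoint]
    rw [Finset.disjoint_right]
    intro a ha haD
    rcases mem_union.mp haD with h | h
    · exact (hAW a ha).1 (mem_filter.mp h).2
    · exact (hAW a ha).2 (mem_filter.mp h).2
  set T : Finset (Finset α) := ((P \\ P) ∪ (Q \\ Q) ∪ (P ⊼ Q)) ∪ Θ with hT
  -- every term of `T` is small; all but the exceptional meets are terms of `scTerms`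
  have hTsmall : ∀ t ∈ T, (t ∈ scTerms P Q W ∨ t ∈ B) ∧ ∃ f ∈ F, t ⊆ f := by
    intro t ht
    rcases mem_union.mp ht with ht | ht
    · rcases mem_union.mp ht with ht | ht
      · rcases mem_union.mp ht with ht | ht
        · obtain ⟨a, ha, b, hb, rfl⟩ := mem_diffs.mp ht
          refine ⟨Or.inl ?_, a, hPF ha, sdiff_subset⟩; unfold scTerms; simp only [mem_union]
          exact Or.inl (Or.inl (Or.inl (Or.inl (Or.inl (Or.inl (Or.inl (mem_diffs.mpr ⟨a, ha, b, hb, rfl⟩)))))))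
        · obtain ⟨a, ha, b, hb, rfl⟩ := mem_diffs.mp ht
          refine ⟨Or.inl ?_, a, hQF ha, sdiff_subset⟩; unfold scTerms; simp only [mem_union]
          exact Or.inl (Or.inl (Or.inl (Or.inl (Or.inl (Or.inl (Or.inr (mem_diffs.mpr ⟨a, ha, b, hb, rfl⟩)))))))
      · obtain ⟨p, hp, q, hq, rfl⟩ := mem_infs.mp ht
        exact ⟨hmeet p hp q hq, p, hPF hp, inter_subset_left⟩
    · rcases mem_union.mp ht with ht | ht
      · exact ⟨Or.inl (hDsmall t ht).1, (hDsmall t ht).2.1⟩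
      · exact ⟨Or.inl (hAT t ht).1, (hAT t ht).2⟩
  -- the rank argument on `H`
  set M : ℕ := #U with hM
  let r : Finset α → ℤ := fun s => (if s ∈ P then 0 else (M : ℤ) + 1) - (#s : ℤ)
  have h0T : (∅ : Finset α) ∈ T :=
    mem_union_left _ (mem_union_left _ (mem_union_left _ (mem_diffs.mpr ⟨p₀, hp₀, p₀, hp₀, (by simp : p₀ \ p₀ = ∅)⟩)))
  have hΘT : Θ ⊆ T := subset_union_right
  have hΘnot : ∀ t, (t ∈ (P \\ P) ∪ (Q \\ Q) ∨ ∃ p ∈ P, ∃ q ∈ Q, t = p ∩ q) → t ∉ Θ := by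
    intro t ht hmem
    rcases mem_union.mp hmem with hD | hA
    · rcases ht with ht | ⟨p, hp, q, hq, rfl⟩
      · exact (hDsmall t hD).2.2.1 ht
      · exact (hDsmall _ hD).2.2.2 p hp q hq rfl
    · rcases ht with ht | ⟨p, hp, q, hq, rfl⟩
      · exact hApure t hA ht
      · exact hAmeet _ hA p hp q hq rfl
  have h0Θ : (∅ : Finset α) ∉ Θ :=
    hΘnot ∅ (Or.inl (mem_union_left _ (mem_diffs.mpr ⟨p₀, hp₀, p₀, hp₀, (by simp : p₀ \ p₀ = ∅)⟩)))
  have hres : #H + #Θ ≤ #T := by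
    refine ReservedTerms.card_add_card_le_card_of_reserved H T Θ r h0T hΘT h0Θ ?_
    intro f hf g hg hne hr
    rcases mem_union.mp hf with hfP | hfc <;> rcases mem_union.mp hg with hgP | hgc
    · -- `P`/`P`
      have hle : #g ≤ #f := by
        have : r f ≤ r g := hr
        simp only [r, if_pos hfP, if_pos hgP] at this; omega
      refine ⟨mem_union_left _ (mem_union_left _ (mem_union_left _ (mem_diffs.mpr ⟨f, hfP, g, hgP, rfl⟩))), ?_, ?_⟩
      · intro h0; exact hne (eq_of_subset_of_card_le (sdiff_eq_empty_iff_subset.mp h0) hle)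
      · exact hΘnot _ (Or.inl (mem_union_left _ (mem_diffs.mpr ⟨f, hfP, g, hgP, rfl⟩)))
    · -- `P` before `co Q`: the meet `f ∩ q`
      obtain ⟨q, hq, rfl⟩ := mem_image.mp hgc
      have hmeet : f \ (U \ q) = f ∩ q := by
        ext i; simp only [mem_sdiff, mem_inter]
        constructor
        · rintro ⟨hif, h⟩
          refine ⟨hif, ?_⟩
          by_contra hiq; exact h ⟨hU f (hPF hfP) hif, hiq⟩
        · rintro ⟨hif, hiq⟩; exact ⟨hif, fun h => h.2 hiq⟩
      rw [hmeet]
      refine ⟨mem_union_left _ (mem_union_right _ (mem_infs.mpr ⟨f, hfP, q, hq, rfl⟩)),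
        (hint f (hPF hfP) q (hQF hq)).ne_empty, hΘnot _ (Or.inr ⟨f, hfP, q, hq, rfl⟩)⟩
    · -- `co Q` before `P`: impossible along `r`
      exfalso
      have hfP' : f ∉ P := fun h => (Finset.disjoint_left.mp hdisj) h hfc
      have : r f ≤ r g := hr
      simp only [r, if_neg hfP', if_pos hgP] at this
      obtain ⟨q, hq, rfl⟩ := mem_image.mp hfc
      have : #(U \ q) ≤ M := card_le_card sdiff_subset
      omega
    · -- `co Q`/`co Q`
      obtain ⟨q, hq, rfl⟩ := mem_image.mp hfc
      obtain ⟨q', hq', rfl⟩ := mem_image.mp hgc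
      have hfP' : U \ q ∉ P := fun h => (Finset.disjoint_left.mp hdisj) h hfc
      have hgP' : U \ q' ∉ P := fun h => (Finset.disjoint_left.mp hdisj) h hgc
      have hle : #(U \ q') ≤ #(U \ q) := by
        have : r (U \ q) ≤ r (U \ q') := hr
        simp only [r, if_neg hfP', if_neg hgP'] at this; omega
      have hdiff : (U \ q) \ (U \ q') = q' \ q := by
        ext i; simp only [mem_sdiff]
        constructor
        · rintro ⟨⟨hiU, hiq⟩, h⟩
          exact ⟨by by_contra h'; exact h ⟨hiU, h'⟩, hiq⟩
        · rintro ⟨hiq', hiq⟩; exact ⟨⟨hU q' (hQF hq') hiq', hiq⟩, fun h => h.2 hiq'⟩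
      rw [hdiff]
      refine ⟨mem_union_left _ (mem_union_left _ (mem_union_right _ (mem_diffs.mpr ⟨q', hq', q, hq, rfl⟩))), ?_, ?_⟩
      · intro h0
        have hsub : q' ⊆ q := sdiff_eq_empty_iff_subset.mp h0
        have : U \ q ⊆ U \ q' := sdiff_subset_sdiff subset_rfl hsub
        exact hne (eq_of_subset_of_card_le this hle)
      · exact hΘnot _ (Or.inl (mem_union_right _ (mem_diffs.mpr ⟨q', hq', q, hq, rfl⟩)))
  -- `T` consists of small terms: `#clU U T = 2 #T` and `clU U T ⊆ clU U (scTerms P Q W)`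
  have hTU : ∀ t ∈ T, t ⊆ U := by
    intro t ht
    obtain ⟨-, f, hf, htf⟩ := hTsmall t ht
    exact htf.trans (hU f hf)
  set Tg : Finset (Finset α) := T.filter fun t => t ∈ scTerms P Q W with hTg
  have hTgT : Tg ⊆ T := filter_subset _ _
  have hTcount : #T ≤ #Tg + #B := by
    have hsplit := card_filter_add_card_filter_not (s := T) (fun t => t ∈ scTerms P Q W)
    have hbad : T.filter (fun t => ¬ t ∈ scTerms P Q W) ⊆ B := by
      intro t ht
      obtain ⟨htT, hnot⟩ := mem_filter.mp ht
      rcases (hTsmall t htT).1 with h | h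
      · exact absurd h hnot
      · exact h
    have := card_le_card hbad
    rw [← hTg] at hsplit
    omega
  have hclT : #(clU U Tg) = 2 * #Tg := by
    unfold clU
    have hinj : Set.InjOn (fun s : Finset α => U \ s) ↑Tg := by
      intro s hs t ht hst
      have h1 := congrArg (fun x => U \ x) hst
      simp only [hcc (hTU s (hTgT (mem_coe.mp hs))), hcc (hTU t (hTgT (mem_coe.mp ht)))] at h1
      exact h1
    have hd : Disjoint Tg (Tg.image fun s => U \ s) := by
      rw [Finset.disjoint_left]
      intro t ht htc
      obtain ⟨s, hs, hst⟩ := mem_image.mp htc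
      obtain ⟨-, f, hf, htf⟩ := hTsmall t (hTgT ht)
      obtain ⟨-, g, hg, hsg⟩ := hTsmall s (hTgT hs)
      apply hcov f hf g hg
      apply Subset.antisymm (union_subset (hU f hf) (hU g hg))
      intro i hiU
      rw [mem_union]
      by_cases his : i ∈ s
      · exact Or.inr (hsg his)
      · have : i ∈ U \ s := mem_sdiff.mpr ⟨hiU, his⟩
        rw [hst] at this
        exact Or.inl (htf this)
    rw [card_union_of_disjoint hd, card_image_of_injOn hinj]; ring
  have hsTU : ∀ t ∈ scTerms P Q W, t ⊆ U := ExtReserved.scTerms_subset_ground hU hWU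
  have hsub : clU U Tg ⊆ clU U (scTerms P Q W) := by
    intro s hs
    rcases mem_clU.mp hs with h | ⟨t, ht, rfl⟩
    · exact mem_clU.mpr (Or.inl (mem_filter.mp h).2)
    · exact compl_mem_clU hsTU (hTU t (hTgT ht)) (mem_clU.mpr (Or.inl (mem_filter.mp ht).2))
  have := card_le_card hsub
  rw [hclT] at this
  omega


/-! ### Appended (hp-7 gen 80): the UNIFORM hybrid-X criterion — free pairs paid by the free admissible cross differences -/

/-- **The uniform hybrid-X criterion** (hp-7 gen 80).  Dead-like blocks `P`, `Q` in `U` with blockers `W` as in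
`two_mul_card_le_card_clU_scTerms_of_saturated`.  Let `A` be the cross differences `d = p \ q` resp. `d = q \ p` that are pure (not within-block
differences), 'never a meet' (`d ⊄ q'` for all `q' ∈ Q`, resp. `d ⊄ p'` for all `p' ∈ P`) and undesignated (`d ∉ W`, `U \ d ∉ W`), and let `B` be the
cross meets `p ∩ q` that are not terms of `scTerms P Q W`.  If `#B ≤ #A` then `2 (#P + #Q + #W) ≤ #clU U (scTerms P Q W)`.  (For a blocked pair the meet is a
term, so `B` only sees the free pairs; `A = B = ∅` is the pair-saturated case.) -/
theorem two_mul_card_le_card_clU_scTerms_of_card_badMeets_le (P Q W : Finset (Finset α))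
    (hU : ∀ a ∈ P ∪ Q, a ⊆ U)
    (hint : ∀ a ∈ P ∪ Q, ∀ b ∈ P ∪ Q, (a ∩ b).Nonempty) (hcov : ∀ a ∈ P ∪ Q, ∀ b ∈ P ∪ Q, a ∪ b ≠ U)
    (hrep : W ⊆ scReps U P Q) (hWco : ∀ a ∈ W, ∀ b ∈ W, a ≠ U \ b)
    (hC2 : ∀ w ∈ W, w ∉ clU U ((P \\ P) ∪ (Q \\ Q)))
    (hX1W : ∀ w ∈ W, ∀ q ∈ Q, ¬ w ⊆ q) (hX2W : ∀ p ∈ P, ∀ w ∈ W, p ∪ w ≠ U)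
    (hcount : #((P ⊼ Q).filter fun t => t ∉ scTerms P Q W) ≤
      #((((P \\ Q).filter fun d => d ∉ (P \\ P) ∪ (Q \\ Q) ∧ (∀ q ∈ Q, ¬ d ⊆ q) ∧ d ∉ W ∧ U \ d ∉ W)) ∪
        ((Q \\ P).filter fun d => d ∉ (P \\ P) ∪ (Q \\ Q) ∧ (∀ p ∈ P, ¬ d ⊆ p) ∧ d ∉ W ∧ U \ d ∉ W))) :
    2 * (#P + #Q + #W) ≤ #(clU U (scTerms P Q W)) := by
  classical
  set A : Finset (Finset α) :=
    ((P \\ Q).filter fun d => d ∉ (P \\ P) ∪ (Q \\ Q) ∧ (∀ q ∈ Q, ¬ d ⊆ q) ∧ d ∉ W ∧ U \ d ∉ W) ∪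
    ((Q \\ P).filter fun d => d ∉ (P \\ P) ∪ (Q \\ Q) ∧ (∀ p ∈ P, ¬ d ⊆ p) ∧ d ∉ W ∧ U \ d ∉ W) with hAdef
  set B : Finset (Finset α) := (P ⊼ Q).filter fun t => t ∉ scTerms P Q W with hBdef
  refine two_mul_card_le_card_clU_scTerms_of_freePaid P Q W A B hU hint hcov hrep hWco hC2 hX1W hX2W ?_ ?_ ?_ ?_ ?_ hcount
  · -- every meet is a term or in `B`
    intro p hp q hq
    by_cases h : p ∩ q ∈ scTerms P Q W
    · exact Or.inl h
    · exact Or.inr (mem_filter.mpr ⟨mem_infs.mpr ⟨p, hp, q, hq, rfl⟩, h⟩)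
  · -- members of `A` are cross differences: terms below members
    intro a ha
    rcases mem_union.mp ha with ha | ha
    · obtain ⟨hd, -⟩ := mem_filter.mp ha
      obtain ⟨p, hp, q, hq, rfl⟩ := mem_diffs.mp hd
      refine ⟨?_, p, mem_union_left _ hp, sdiff_subset⟩
      unfold scTerms; simp only [mem_union]
      exact Or.inl (Or.inl (Or.inl (Or.inl (Or.inl (Or.inr (mem_diffs.mpr ⟨p, hp, q, hq, rfl⟩))))))
    · obtain ⟨hd, -⟩ := mem_filter.mp ha
      obtain ⟨q, hq, p, hp, rfl⟩ := mem_diffs.mp hd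
      refine ⟨?_, q, mem_union_right _ hq, sdiff_subset⟩
      unfold scTerms; simp only [mem_union]
      exact Or.inl (Or.inl (Or.inl (Or.inl (Or.inr (mem_diffs.mpr ⟨q, hq, p, hp, rfl⟩)))))
  · -- pure
    intro a ha
    rcases mem_union.mp ha with ha | ha
    · exact (mem_filter.mp ha).2.1
    · exact (mem_filter.mp ha).2.1
  · -- never a meet
    intro a ha p hp q hq hapq
    rcases mem_union.mp ha with ha | ha
    · exact (mem_filter.mp ha).2.2.1 q hq (hapq ▸ inter_subset_right)
    · exact (mem_filter.mp ha).2.2.1 p hp (hapq ▸ inter_subset_left)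
  · -- undesignated
    intro a ha
    rcases mem_union.mp ha with ha | ha
    · exact (mem_filter.mp ha).2.2.2
    · exact (mem_filter.mp ha).2.2.2

end Hybrid

end Summit.CriticalPhenomena.PercolationContinuityZ3.Theorems
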